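import Literature.NumberTheory.DiophantineGeometry.FunctionFieldFundamentalEquality
import Literature.NumberTheory.DiophantineGeometry.FunctionFieldArtinSchreierIrreducible
import HarnessLib

/-!
# Total ramification of `yⁿ - y = w` at a simple pole of `w` (Stichtenoth Prop. 3.7.8 (b), `m_P = 1`)

Topic: `Literature/NumberTheory/DiophantineGeometry`. Let `F'/F` be an extension of algebraic function
fields over `K` of degree `≤ n` (`n ≥ 2`) containing an element `y` with `yⁿ - y = w ∈ F`, and let `P`
be a place of `F` with `v_P(w) = -1`. Then for every place `P'` of `F'` above `P`:

* `v_{P'}(y) = -1`, `e(P'|P) = n = [F' : F]`, `P'` is the ONLY place of `F'` above `P`, and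
  `deg P' = deg P` (`PlaceOver.totallyRamified_of_pow_sub_eq`).

This is the valuation-theoretic heart of the theory of Artin–Schreier extensions
[Stichtenoth 2009, Prop. 3.7.8 (b)/(a), with `m_P = 1`]: `v_{P'}(yⁿ - y) = -e(P'|P)` forces
`v_{P'}(y) < 0`, so `n v_{P'}(y) = -e(P'|P)`, whence `e ≥ n ≥ [F' : F] ≥ e` (fundamental equality).
No hypothesis on the characteristic is made (for `n = q = p^s` the polynomial `Yⁿ - Y` is additive and
any `w' = w + (z^q - z)` may replace `w`); it is the step `e(P_{i+1}|P_i) = ℓ`, `v_{P_{i+1}}(x_{i+1}) = -1`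
of [Stichtenoth 2009, Lemma 7.4.3] for the Garcia–Stichtenoth tower.

## References

* H. Stichtenoth, *Algebraic Function Fields and Codes*, 2nd ed., GTM 254, Springer 2009:
  Prop. 3.7.8, Prop. 3.7.10, Lemma 7.4.3. [Stichtenoth2009]
-/

noncomputable section

open scoped Classical

namespace Literature.NumberTheory.DiophantineGeometry.AlgFunctionField

namespace PlaceOver

universe u v

variable {K : Type u} {F : Type v} {F' : Type v} [Field K] [Field F] [Algebra K F]
variable [Field F'] [Algebra F F'] [Algebra K F'] [IsScalarTower K F F']
variable [IsAlgFunctionField K F] [FiniteDimensional F F'] [IsAlgFunctionField K F']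

omit [IsAlgFunctionField K F'] in
/-- **Valuations in `yⁿ - y = w` above a simple pole of `w`.** If `v_P(w) = -1`, `yⁿ - y = w` in
`F' ⊇ F` (`n ≥ 2`) and `P'` lies above `P`, then `v_{P'}(y) < 0` and
`n · (-v_{P'}(y)) = e(P'|P)`. [cite: Stichtenoth2009, Prop. 3.7.8 (proof)] -/
theorem ord_mul_eq_of_pow_sub_eq {P : PlaceOver K F} {P' : PlaceOver K F'}
    (h : P'.restrict (K := K) (F := F) = P) {y : F'} {w : F} {n : ℕ} (hn : 2 ≤ n)
    (hy : y ^ n - y = algebraMap F F' w) (hw : P.ord w = -1) :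
    P'.ord y < 0 ∧ (n : ℤ) * (-P'.ord y) = P'.ord (algebraMap F F' (P.uniformizer : F)) := by
  have hw0 : w ≠ 0 := P.ne_zero_of_ord_ne_zero (by rw [hw]; norm_num)
  have he := P'.one_le_ord_algebraMap_uniformizer (K := K) (F := F)
  rw [h] at he
  have hordw : P'.ord (algebraMap F F' w) = -P'.ord (algebraMap F F' (P.uniformizer : F)) := by
    have := P'.ord_algebraMap_eq_mul (K := K) w
    rw [h, hw] at this; rw [this]; ring
  have hw'0 : algebraMap F F' w ≠ 0 := (_root_.map_ne_zero _).2 hw0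
  have hy0 : y ≠ 0 := by
    rintro rfl
    rw [zero_pow (by omega), sub_zero] at hy
    exact hw'0 hy.symm
  -- `v_{P'}(y) < 0`
  have hyneg : P'.ord y < 0 := by
    by_contra hnn
    push Not at hnn
    have hyO : y ∈ P'.toValuationSubring := (P'.mem_toValuationSubring_iff_ord_nonneg hy0).2 hnn
    have hmem : y ^ n - y ∈ P'.toValuationSubring := sub_mem (pow_mem hyO n) hyO
    rw [hy, P'.mem_toValuationSubring_iff_ord_nonneg hw'0, hordw] at hmem
    omega
  refine ⟨hyneg, ?_⟩
  -- strict triangle inequality: `v(yⁿ - y) = n v(y)`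
  have hpow : P'.ord (y ^ n) = n * P'.ord y := P'.ord_pow hy0 n
  have hlt : P'.ord (y ^ n) < P'.ord (-y) := by
    rw [hpow, P'.ord_neg]
    have : (n : ℤ) * P'.ord y ≤ 2 * P'.ord y := by nlinarith
    omega
  have hst := P'.ord_add_eq_left_of_lt (pow_ne_zero n hy0) (neg_ne_zero.2 hy0) hlt
  rw [← sub_eq_add_neg, hy, hordw, hpow] at hst
  linarith [hst.2]

omit [IsAlgFunctionField K F'] in
/-- **Integrality**: if `yⁿ - y = w` (`n ≥ 2`) with `w ∈ 𝒪_P` and `P'` lies above `P`, then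
`y ∈ 𝒪_{P'}` (otherwise `v_{P'}(yⁿ - y) = n v_{P'}(y) < 0 ≤ v_{P'}(w)`).
[cite: Stichtenoth2009, Prop. 3.7.8 (proof)] -/
theorem mem_of_pow_sub_eq {P : PlaceOver K F} {P' : PlaceOver K F'}
    (h : P'.restrict (K := K) (F := F) = P) {y : F'} {w : F} {n : ℕ} (hn : 2 ≤ n)
    (hy : y ^ n - y = algebraMap F F' w) (hw : w ∈ P.toValuationSubring) :
    y ∈ P'.toValuationSubring := by
  by_cases hy0 : y = 0
  · rw [hy0]; exact zero_mem _
  by_contra hyO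
  have hyneg : P'.ord y < 0 := by
    rwa [P'.mem_toValuationSubring_iff_ord_nonneg hy0, not_le] at hyO
  have hpow : P'.ord (y ^ n) = n * P'.ord y := P'.ord_pow hy0 n
  have hlt : P'.ord (y ^ n) < P'.ord (-y) := by
    rw [hpow, P'.ord_neg]
    have : (n : ℤ) * P'.ord y ≤ 2 * P'.ord y := by nlinarith
    omega
  have hst := P'.ord_add_eq_left_of_lt (pow_ne_zero n hy0) (neg_ne_zero.2 hy0) hlt
  rw [← sub_eq_add_neg, hy, hpow] at hst
  have hwO : algebraMap F F' w ∈ P'.toValuationSubring := by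
    rw [← P'.mem_restrict_iff (K := K) (F := F), h]; exact hw
  have := P'.ord_nonneg_of_mem hwO
  rw [hst.2] at this
  nlinarith

/-- **Total ramification above a simple pole** (Stichtenoth Prop. 3.7.8 (a)–(b) with `m_P = 1`;
Lemma 7.4.3): if moreover `[F' : F] ≤ n`, then `v_{P'}(y) = -1`, `e(P'|P) = n = [F' : F]`, `P'`
is the only place above `P`, and `deg P' = deg P`. [cite: Stichtenoth2009, Prop. 3.7.8 and Lemma 7.4.3] -/
theorem totallyRamified_of_pow_sub_eq {P : PlaceOver K F} {P' : PlaceOver K F'}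
    (h : P'.restrict (K := K) (F := F) = P) {y : F'} {w : F} {n : ℕ} (hn : 2 ≤ n)
    (hdeg : Module.finrank F F' ≤ n) (hy : y ^ n - y = algebraMap F F' w) (hw : P.ord w = -1) :
    P'.ord y = -1 ∧ P'.ord (algebraMap F F' (P.uniformizer : F)) = n ∧ Module.finrank F F' = n ∧
      (∀ P'' : PlaceOver K F', P''.restrict (K := K) (F := F) = P → P'' = P') ∧
      P'.degree = P.degree := by
  obtain ⟨hyneg, hmul⟩ := ord_mul_eq_of_pow_sub_eq h hn hy hw
  have hle := ord_algebraMap_uniformizer_le_finrank h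
  have h1 : (n : ℤ) * (-P'.ord y) ≤ n := by
    calc (n : ℤ) * (-P'.ord y) = _ := hmul
      _ ≤ Module.finrank F F' := hle
      _ ≤ n := by exact_mod_cast hdeg
  have hy1 : P'.ord y = -1 := by
    have : (n : ℤ) * (-P'.ord y) ≤ n * 1 := by linarith
    have := le_of_mul_le_mul_left this (by exact_mod_cast (by omega : 0 < n))
    omega
  rw [hy1, neg_neg, mul_one] at hmul
  have hfin : Module.finrank F F' = n := by
    apply le_antisymm hdeg
    have : (n : ℤ) ≤ Module.finrank F F' := hmul ▸ hle
    exact_mod_cast this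
  have htot := eq_of_ord_algebraMap_uniformizer_eq_finrank h (by rw [← hmul, hfin])
  exact ⟨hy1, hmul.symm, hfin, htot.1, htot.2⟩

end PlaceOver

end Literature.NumberTheory.DiophantineGeometry.AlgFunctionField
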